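import Literature.NumberTheory.EllipticCurves.ThreeTorsionWildInertiaRootsProofs
import Literature.NumberTheory.EllipticCurves.DivisionField
import Literature.NumberTheory.EllipticCurves.DivisionPolynomialTorsion
import Mathlib.Tactic.Module
import HarnessLib

/-!
# The wild conductor of `E[3]` above `2` through `K(E[3]) ⊇ K(x(E[3]))`: the user-facing form

`Proofs` file (theorems only, no definitions, no named facts) in topic
`NumberTheory/EllipticCurves`, landed by the seat of bsd.S15
(`Literature.NumberTheory.EllipticCurves.conductorNorm_eq_artinConductorNat_of_isElliptic`).  It
specialises the type-free Galois side of Ogg's formula above `2`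
(`ThreeTorsionCentralInvolutionSwanProofs`, `ThreeTorsionWildInertiaRootsProofs`; Silverman *ATAEC*
Thm. IV.11.1, `p = 2`, PDF p. 366) to the named fields `L = divisionField W 3 = K(E[3])` and
`E = xDivisionField W 3 = K(x(E[3]))` of `DivisionField`, discharging the field-theoretic
hypotheses (`hL`, `hLf`, `hle`, `hkerE`) once and for all, and replaces the hypothesis on the
`x`-coordinates by the `3`-division polynomial:

* `eval_divisionPolynomial_three_eq_zero_of_eq_some` — the `x`-coordinate of a non-zero point of `E[3]` is a root of
  `Ψ₃ = 3x⁴ + b₂x³ + 3b₄x² + 3b₆x + b₈` (a `3`-torsion point is not `2`-torsion, and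
  `3P = O ↔ Ψ₃(x) = 0` off `E[2]`, `three_smul_some_eq_zero_iff`, Silverman *AEC* Ex. 3.7);
* `x_mem_of_roots_divisionPolynomial_three_eq` — hence, if `Ψ₃` has the roots `x₁, x₂, x₃, x₄` in `K̄`, every non-zero
  `T ∈ E[3]` has `x(T) ∈ {x₁, x₂, x₃, x₄}`; and `exists_geomTorsion_three_of_roots_divisionPolynomial_three_eq` — each
  `x_j` is attained (the four lines of `E[3] ≅ 𝔽₃²` have four distinct `x`-coordinates);
* `absRestrictNormalHom_xDivisionField_eq_one_iff_divisionField` — `σ|_{K(x(E[3]))} = 1 ↔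
  σ|_{K(E[3])} ∈ {1, ι}` for `ι` acting as `-1`;
* `exists_central_involution_divisionField_three` — if `K(E[3])` is wildly ramified at `𝔓 ∣ 2`
  then some `ι ∈ G₁(𝔓 ∩ K(E[3]))`, `ι² = 1 ≠ ι`, acts as `-1` on `E[3]`;
* `swanConductorAt_torsion_three_eq_two_mul_herbrandPhi_xDivisionField` —
  **`Sw_𝔓(E[3]) = 2 φ_{K(x(E[3]))/K}(b)`**, `b = i_{Gal(K(E[3])/K)}(ι) - 1`;
* `card_ramificationSubgroup_one_eq_two_pow_of_mem_primesAbove` (`#G₁ = 2^{v₂(#G₀)}` above `2`),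
  `card_ramificationSubgroup_zero/one_divisionField_three_eq_two_mul` (`#G_i(K(E[3])) = 2 #Q_i(K(x(E[3])))`,
  `i = 0, 1`) — the cardinality bookkeeping (`#Q₁ = 4` from `8 ∣ e ∣ 24`);
* `card_mul_swanConductorAt_torsion_three_eq_of_roots_divisionPolynomial_three` —
  **`#Q₀ · Sw_𝔓(E[3]) = 2 (b + Σ_{j=2}^{4} (m_j - n))`** for quaternion wild inertia
  (`#Q₁(𝔓 ∩ K(x(E[3]))) = 4`), from the roots of `Ψ₃` and the test elements `Z, Z_j` of
  `card_mul_herbrandPhi_eq_of_roots`.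

## How to use (recipe for one curve or one family, `K = ℚ`, `v = 2`, `𝔓 ∣ 2`)

1. `L := W.divisionField 3`, `E := W.xDivisionField 3`; the field-theoretic hypotheses are
   discharged in this file.
2. Ramification index: from an element of `S_L` of known `𝔓_L`-order (e.g. a root difference,
   see 4.) get `e = e(𝔓 ∩ L ∣ 2) = #G₀ ∈ {2, 4, 6, 8, 24}` (`ramificationIdx'_under_eq_card_inertia`);
   `#G₁ = 2^{v₂(e)}` (`card_ramificationSubgroup_one_eq_two_pow_of_mem_primesAbove`), so `G₁ ≠ 1`
   and `exists_central_involution_divisionField_three` gives `ι`; `#Q₁ = #G₁ / 2`, `#Q₀ = e / 2`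
   (`card_ramificationSubgroup_one/zero_divisionField_three_eq_two_mul`).
3. `b`: with `w := 27(2y₁ + a₁x₁ + a₃) ∈ S_L` (`ι w = -w`) and any `t ∈ S_L` with `v_{𝔓_L}(w - t)` odd,
   `b = v(2w) - v(w - t)` (`lowerIndex_eq_of_smul_eq_neg`, `CentralInvolutionBreakProofs`).
   If `#G₁ = 2` this already gives `Sw = 2φ_{E/K}(b) = 2b/#Q₀`
   (`swanConductorAt_torsion_three_eq_two_mul_herbrandPhi_xDivisionField`, `Q₁ = 1`).
4. `#G₁ = 8` (quaternion): the roots `x₁, …, x₄` of `Ψ₃` and test elements `Z = P(x₁)`,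
   `Z_j = P(x_j)` in `S_E` with `v(Z) = n` odd, `v(Z_j - Z) = m_j`; then
   `#Q₀ · Sw = 2 (b + Σ_j (m_j - n))`
   (`card_mul_swanConductorAt_torsion_three_eq_of_roots_divisionPolynomial_three`).  Useful
   uniformity: if `x = u²x' + r` puts `E` in a good-reduction model over the inertia field, the
   `x'_j` reduce to the four distinct `x`-coordinates `0, 1, ω, ω²` of the `3`-torsion of
   `y² + y = x³` over `𝔽₄`, so `v(x_i - x_j) = 2v(u) = e·v₂(Δ)/6` for all `i ≠ j`.
   (`#G₁ = 4`, cyclic wild inertia, does not need 4.: `Q₁ = {1, τ̄}` and Lemma 3 directly.)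

## References

* J. H. Silverman, *Advanced Topics in the Arithmetic of Elliptic Curves*, GTM 151 (1994), §IV.10
  (Definition of `δ` with `L = K(E[ℓ])`, PDF p. 358), Thm. IV.11.1 (`p = 2`: p. 366).
  [SilvermanATAEC1994]
* J. H. Silverman, *The Arithmetic of Elliptic Curves*, 2nd ed. (2009), III.2.3, Exercise 3.7
  (division polynomials), Cor. III.6.4, VIII.§1. [SilvermanAEC2009]
* J.-P. Serre, *Local Fields*, GTM 67 (1979), Ch. IV §§1–3. [SerreLocalFields1979]

## Design

No definitions.  `K` is a number field (so `char K = 0` and the instances of `DivisionField`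
apply); `noncomputable section`; namespace `WeierstrassCurve`; local instance
`AddSubgroup.torsionBy.zmodModule`.  Axioms: `propext`, `Classical.choice`, `Quot.sound`.
-/

noncomputable section

open scoped Classical NumberField
open Field IsDedekindDomain MeasureTheory Polynomial

universe u

namespace WeierstrassCurve

open Literature.NumberTheory.EllipticCurves Literature.NumberTheory.GaloisRepresentations

attribute [local instance] AddSubgroup.torsionBy.zmodModule

/-! ### The `x`-coordinates of `E[3]` and the roots of `Ψ₃` -/

section Roots

variable {F : Type u} [Field F] (W : WeierstrassCurve F)

/-- **`3P = O` forces `Ψ₃(x(P)) = 0`** for an affine point `P = (x, y)` of a Weierstrass curve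
over a field: `P` is not `2`-torsion (else `P = 3P - 2P = O`), so Silverman's Exercise 3.7,
`3P = O ↔ ψ₃(P) = 0` off `E[2]` (`three_smul_some_eq_zero_iff`), applies.
[cite: SilvermanAEC2009, Exercise 3.7 and III.2.3] -/
theorem eval_divisionPolynomial_three_eq_zero_of_three_smul_eq_zero {K' : Type*} [Field K'] {V : WeierstrassCurve K'}
    {x y : K'} {h : V.toAffine.Nonsingular x y}
    (h3 : ((3 : ℕ) : ℤ) • (Affine.Point.some x y h : V.toAffine.Point) = 0) : V.Ψ₃.eval x = 0 := by
  -- `P` is not `2`-torsion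
  have hy : y ≠ V.toAffine.negY x y := by
    intro hy
    have hneg : -(Affine.Point.some x y h : V.toAffine.Point) = Affine.Point.some x y h := by
      rw [Affine.Point.neg_some]
      have hns : V.toAffine.Nonsingular x (V.toAffine.negY x y) := by rw [← hy]; exact h
      change (Affine.Point.some x (V.toAffine.negY x y) _ : V.toAffine.Point) = _
      simp only [← hy]
    have h2 : (Affine.Point.some x y h : V.toAffine.Point) + Affine.Point.some x y h = 0 := by
      nth_rewrite 2 [← hneg]
      exact add_neg_cancel _
    have e : ((3 : ℕ) : ℤ) • (Affine.Point.some x y h : V.toAffine.Point) =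
        (Affine.Point.some x y h + Affine.Point.some x y h) + Affine.Point.some x y h := by
      rw [show ((3 : ℕ) : ℤ) = 1 + 1 + 1 by norm_num, add_zsmul, add_zsmul, one_zsmul]
    rw [e, h2, zero_add] at h3
    exact absurd h3 (by rintro ⟨⟩)
  have h3' : (3 : ℤ) • (Affine.Point.some x y h : V.toAffine.Point) = 0 := by exact_mod_cast h3
  have key := (three_smul_some_eq_zero_iff (V := V) h hy).mp h3'
  rw [ψ_three, evalEval_C] at key
  exact key

/-- **The `x`-coordinate of a non-zero `3`-torsion point is a root of `Ψ₃`** (of the base-changed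
curve over `F̄`): `eval_divisionPolynomial_three_eq_zero_of_three_smul_eq_zero` for the geometric points.
[cite: SilvermanAEC2009, Exercise 3.7 and III.2.3] -/
theorem eval_divisionPolynomial_three_eq_zero_of_eq_some {T : geomTorsion W (3 : ℕ)} {x y : AlgebraicClosure F}
    {h : (W.baseChange (AlgebraicClosure F)).toAffine.Nonsingular x y}
    (hT : (T : geomPoints W) = Affine.Point.some x y h) :
    (W.baseChange (AlgebraicClosure F)).Ψ₃.eval x = 0 := by
  have hval : ((3 : ℕ) : ℤ) • (T : geomPoints W) = 0 := mem_torsionBy_iff.mp T.2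
  rw [hT] at hval
  exact eval_divisionPolynomial_three_eq_zero_of_three_smul_eq_zero hval

/-- If `Ψ₃` (over `F̄`) has the roots `x₁, x₂, x₃, x₄`, then the `x`-coordinate of every non-zero
point of `E[3]` is one of them (`eval_divisionPolynomial_three_eq_zero_of_eq_some`; `Ψ₃ ≠ 0` in characteristic `0`,
its leading coefficient being `3`).  Hypothesis `hroots` of `card_mul_herbrandPhi_eq_of_roots`.
[cite: SilvermanAEC2009, Exercise 3.7] -/
theorem x_mem_of_roots_divisionPolynomial_three_eq [CharZero F] {x₁ x₂ x₃ x₄ : AlgebraicClosure F}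
    (hΨ : (W.baseChange (AlgebraicClosure F)).Ψ₃.roots = {x₁, x₂, x₃, x₄})
    (T : geomTorsion W (3 : ℕ)) (x y : AlgebraicClosure F)
    (h : (W.baseChange (AlgebraicClosure F)).toAffine.Nonsingular x y)
    (hT : (T : geomPoints W) = Affine.Point.some x y h) : x = x₁ ∨ x = x₂ ∨ x = x₃ ∨ x = x₄ := by
  have hne : (W.baseChange (AlgebraicClosure F)).Ψ₃ ≠ 0 :=
    Ψ₃_ne_zero _ (by exact_mod_cast (three_ne_zero : (3 : AlgebraicClosure F) ≠ 0))
  have hmem : x ∈ (W.baseChange (AlgebraicClosure F)).Ψ₃.roots := by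
    rw [mem_roots hne, IsRoot.def]
    exact W.eval_divisionPolynomial_three_eq_zero_of_eq_some hT
  rw [hΨ] at hmem
  simpa only [Multiset.insert_eq_cons, Multiset.mem_cons, Multiset.mem_singleton] using hmem

/-- Two geometric points of `E[3]` with the same `x`-coordinate are equal or opposite. [folklore] -/
theorem eq_or_eq_neg_of_x_eq {T T' : geomTorsion W (3 : ℕ)} {x x' y y' : AlgebraicClosure F}
    {h : (W.baseChange (AlgebraicClosure F)).toAffine.Nonsingular x y}
    {h' : (W.baseChange (AlgebraicClosure F)).toAffine.Nonsingular x' y'}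
    (hT : (T : geomPoints W) = Affine.Point.some x y h)
    (hT' : (T' : geomPoints W) = Affine.Point.some x' y' h') (hxx : x' = x) :
    T' = T ∨ T' = -T := by
  subst hxx
  rcases Affine.Y_eq_of_X_eq h'.left h.left rfl with hyy | hyy
  · left
    apply Subtype.ext
    rw [hT, hT']
    subst hyy
    rfl
  · right
    apply Subtype.ext
    rw [AddSubgroup.coe_neg, hT', hT]
    refine Eq.trans ?_ (Affine.Point.neg_some h).symm
    subst hyy
    rfl

/-- **Every root of `Ψ₃` is the `x`-coordinate of a `3`-torsion point** (`E` elliptic, `char F = 0`,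
the four roots distinct): the four lines `{±P}, {±Q}, {±(P + Q)}, {±(P - Q)}` of `E[3] ≅ 𝔽₃²`
(`finrank_geomTorsion_eq_two`) have four pairwise distinct `x`-coordinates among
`{x₁, x₂, x₃, x₄}`, so they exhaust them.  Hypothesis `hT₁` of `card_mul_herbrandPhi_eq_of_roots`.
[cite: SilvermanAEC2009, Exercise 3.7 and Cor. III.6.4] -/
theorem exists_geomTorsion_three_of_roots_divisionPolynomial_three_eq [CharZero F] [W.IsElliptic]
    {x₁ x₂ x₃ x₄ : AlgebraicClosure F}
    (hΨ : (W.baseChange (AlgebraicClosure F)).Ψ₃.roots = {x₁, x₂, x₃, x₄})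
    (h12 : x₁ ≠ x₂) (h13 : x₁ ≠ x₃) (h14 : x₁ ≠ x₄) (h23 : x₂ ≠ x₃) (h24 : x₂ ≠ x₄)
    (h34 : x₃ ≠ x₄) :
    ∃ (T : geomTorsion W (3 : ℕ)) (y : AlgebraicClosure F)
      (h : (W.baseChange (AlgebraicClosure F)).toAffine.Nonsingular x₁ y),
      (T : geomPoints W) = Affine.Point.some x₁ y h := by
  haveI : Fact (Nat.Prime 3) := ⟨Nat.prime_three⟩
  have h3F : ((3 : ℕ) : F) ≠ 0 := by exact_mod_cast (three_ne_zero : (3 : F) ≠ 0)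
  haveI : Finite (geomTorsion W (3 : ℕ)) := W.finite_geomTorsion_nat three_ne_zero
  haveI : Module.Finite (ZMod 3) (geomTorsion W (3 : ℕ)) := Module.Finite.of_finite
  have hrank : Module.finrank (ZMod 3) (geomTorsion W (3 : ℕ)) = 2 := W.finrank_geomTorsion_eq_two 3 h3F
  set B := Module.finBasisOfFinrankEq (ZMod 3) (geomTorsion W (3 : ℕ)) hrank with hB
  set P : geomTorsion W (3 : ℕ) := B 0 with hP
  set Q : geomTorsion W (3 : ℕ) := B 1 with hQ
  -- linear combinations `c₀ P + c₁ Q` vanish only trivially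
  have hcomb : ∀ c₀ c₁ : ZMod 3, c₀ • P + c₁ • Q = 0 → c₀ = 0 ∧ c₁ = 0 := by
    intro c₀ c₁ hc
    have hli := B.linearIndependent
    rw [Fintype.linearIndependent_iff] at hli
    have h := hli ![c₀, c₁] (by
      rw [Fin.sum_univ_two]
      simpa [hP, hQ] using hc)
    exact ⟨h 0, h 1⟩
  -- non-trivial combinations do not vanish
  have hdist : ∀ a b : ZMod 3, (a ≠ 0 ∨ b ≠ 0) → a • P + b • Q ≠ 0 := by
    intro a b hab h0
    obtain ⟨h₀, h₁⟩ := hcomb a b h0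
    rcases hab with h | h
    · exact h h₀
    · exact h h₁
  -- units of `ZMod 3`
  have n1 : (1 : ZMod 3) ≠ 0 := one_ne_zero
  have nm1 : (-1 : ZMod 3) ≠ 0 := neg_ne_zero.mpr one_ne_zero
  have n2 : (2 : ZMod 3) ≠ 0 := by
    intro h
    have h' : ((2 : ℕ) : ZMod 3) = 0 := by exact_mod_cast h
    rw [ZMod.natCast_eq_zero_iff] at h'
    omega
  have nm2 : (-2 : ZMod 3) ≠ 0 := neg_ne_zero.mpr n2
  -- the four representatives `P, Q, P + Q, P - Q` of the lines are pairwise `≠` and `≠ -`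
  have q01 : (Q : geomTorsion W (3 : ℕ)) ≠ P ∧ (Q : geomTorsion W (3 : ℕ)) ≠ -(P) := by
    constructor
    · intro h
      refine hdist (-1) (1) (Or.inl nm1) ?_
      have e : (-1 : ZMod 3) • P + (1 : ZMod 3) • Q = Q - P := by module
      rw [e, sub_eq_zero.mpr h]
    · intro h
      refine hdist (1) (1) (Or.inl n1) ?_
      have e : (1 : ZMod 3) • P + (1 : ZMod 3) • Q = Q + P := by module
      rw [e, h, neg_add_cancel]
  have q02 : (P + Q : geomTorsion W (3 : ℕ)) ≠ P ∧ (P + Q : geomTorsion W (3 : ℕ)) ≠ -(P) := by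
    constructor
    · intro h
      refine hdist (0) (1) (Or.inr n1) ?_
      have e : (0 : ZMod 3) • P + (1 : ZMod 3) • Q = (P + Q) - P := by module
      rw [e, sub_eq_zero.mpr h]
    · intro h
      refine hdist (2) (1) (Or.inl n2) ?_
      have e : (2 : ZMod 3) • P + (1 : ZMod 3) • Q = (P + Q) + P := by module
      rw [e, h, neg_add_cancel]
  have q03 : (P - Q : geomTorsion W (3 : ℕ)) ≠ P ∧ (P - Q : geomTorsion W (3 : ℕ)) ≠ -(P) := by
    constructor
    · intro h
      refine hdist (0) (-1) (Or.inr nm1) ?_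
      have e : (0 : ZMod 3) • P + (-1 : ZMod 3) • Q = (P - Q) - P := by module
      rw [e, sub_eq_zero.mpr h]
    · intro h
      refine hdist (2) (-1) (Or.inl n2) ?_
      have e : (2 : ZMod 3) • P + (-1 : ZMod 3) • Q = (P - Q) + P := by module
      rw [e, h, neg_add_cancel]
  have q12 : (P + Q : geomTorsion W (3 : ℕ)) ≠ Q ∧ (P + Q : geomTorsion W (3 : ℕ)) ≠ -(Q) := by
    constructor
    · intro h
      refine hdist (1) (0) (Or.inl n1) ?_
      have e : (1 : ZMod 3) • P + (0 : ZMod 3) • Q = (P + Q) - Q := by module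
      rw [e, sub_eq_zero.mpr h]
    · intro h
      refine hdist (1) (2) (Or.inl n1) ?_
      have e : (1 : ZMod 3) • P + (2 : ZMod 3) • Q = (P + Q) + Q := by module
      rw [e, h, neg_add_cancel]
  have q13 : (P - Q : geomTorsion W (3 : ℕ)) ≠ Q ∧ (P - Q : geomTorsion W (3 : ℕ)) ≠ -(Q) := by
    constructor
    · intro h
      refine hdist (1) (-2) (Or.inl n1) ?_
      have e : (1 : ZMod 3) • P + (-2 : ZMod 3) • Q = (P - Q) - Q := by module
      rw [e, sub_eq_zero.mpr h]
    · intro h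
      refine hdist (1) (0) (Or.inl n1) ?_
      have e : (1 : ZMod 3) • P + (0 : ZMod 3) • Q = (P - Q) + Q := by module
      rw [e, h, neg_add_cancel]
  have q23 : (P - Q : geomTorsion W (3 : ℕ)) ≠ P + Q ∧ (P - Q : geomTorsion W (3 : ℕ)) ≠ -(P + Q) := by
    constructor
    · intro h
      refine hdist (0) (-2) (Or.inr nm2) ?_
      have e : (0 : ZMod 3) • P + (-2 : ZMod 3) • Q = (P - Q) - (P + Q) := by module
      rw [e, sub_eq_zero.mpr h]
    · intro h
      refine hdist (2) (0) (Or.inl n2) ?_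
      have e : (2 : ZMod 3) • P + (0 : ZMod 3) • Q = (P - Q) + (P + Q) := by module
      rw [e, h, neg_add_cancel]
  have hne0 : ∀ {R : geomTorsion W (3 : ℕ)} (a b : ZMod 3), (a ≠ 0 ∨ b ≠ 0) → R = a • P + b • Q →
      (R : geomPoints W) ≠ 0 := by
    intro R a b hab hRab h0
    apply hdist a b hab
    rw [← hRab]
    exact Subtype.ext h0
  have hP0 : ((P : geomTorsion W (3 : ℕ)) : geomPoints W) ≠ 0 := hne0 1 0 (Or.inl n1) (by module)
  have hQ0 : ((Q : geomTorsion W (3 : ℕ)) : geomPoints W) ≠ 0 := hne0 0 1 (Or.inr n1) (by module)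
  have hPQ0 : ((P + Q : geomTorsion W (3 : ℕ)) : geomPoints W) ≠ 0 := hne0 1 1 (Or.inl n1) (by module)
  have hPQ0' : ((P - Q : geomTorsion W (3 : ℕ)) : geomPoints W) ≠ 0 := hne0 1 (-1) (Or.inl n1) (by module)
  -- coordinates of a non-zero geometric point
  have hcoord : ∀ {R : geomTorsion W (3 : ℕ)}, (R : geomPoints W) ≠ 0 → ∃ (x y : AlgebraicClosure F)
      (h : (W.baseChange (AlgebraicClosure F)).toAffine.Nonsingular x y),
      (R : geomPoints W) = Affine.Point.some x y h := by
    intro R hne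
    rcases hRi : (show (W.baseChange (AlgebraicClosure F)).toAffine.Point from (R : geomPoints W))
      with _ | ⟨x, y, h⟩
    · exact absurd (hRi : (R : geomPoints W) = 0) hne
    · exact ⟨x, y, h, hRi⟩
  obtain ⟨a₀, b₀, ha₀, hR₀⟩ := hcoord hP0
  obtain ⟨a₁, b₁, ha₁, hR₁⟩ := hcoord hQ0
  obtain ⟨a₂, b₂, ha₂, hR₂⟩ := hcoord hPQ0
  obtain ⟨a₃, b₃, ha₃, hR₃⟩ := hcoord hPQ0'
  -- the four `x`-coordinates are pairwise distinct
  have hxne : ∀ {R R' : geomTorsion W (3 : ℕ)} {x x' y y' : AlgebraicClosure F}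
      {h : (W.baseChange (AlgebraicClosure F)).toAffine.Nonsingular x y}
      {h' : (W.baseChange (AlgebraicClosure F)).toAffine.Nonsingular x' y'},
      (R : geomPoints W) = Affine.Point.some x y h → (R' : geomPoints W) = Affine.Point.some x' y' h' →
      (R' ≠ R ∧ R' ≠ -R) → x ≠ x' := by
    intro R R' x x' y y' h h' hR hR' hne hxx
    rcases W.eq_or_eq_neg_of_x_eq hR hR' hxx.symm with heq | heq
    · exact hne.1 heq
    · exact hne.2 heq
  have d01 := hxne hR₀ hR₁ q01
  have d02 := hxne hR₀ hR₂ q02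
  have d03 := hxne hR₀ hR₃ q03
  have d12 := hxne hR₁ hR₂ q12
  have d13 := hxne hR₁ hR₃ q13
  have d23 := hxne hR₂ hR₃ q23
  -- all four lie among the roots; pigeonhole
  have m₀ := W.x_mem_of_roots_divisionPolynomial_three_eq hΨ _ _ _ _ hR₀
  have m₁ := W.x_mem_of_roots_divisionPolynomial_three_eq hΨ _ _ _ _ hR₁
  have m₂ := W.x_mem_of_roots_divisionPolynomial_three_eq hΨ _ _ _ _ hR₂
  have m₃ := W.x_mem_of_roots_divisionPolynomial_three_eq hΨ _ _ _ _ hR₃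
  have hsub : ({a₀, a₁, a₂, a₃} : Finset (AlgebraicClosure F)) ⊆ {x₁, x₂, x₃, x₄} := by
    intro x hx
    simp only [Finset.mem_insert, Finset.mem_singleton] at hx ⊢
    rcases hx with rfl | rfl | rfl | rfl
    · exact m₀
    · exact m₁
    · exact m₂
    · exact m₃
  have hcardS : ({a₀, a₁, a₂, a₃} : Finset (AlgebraicClosure F)).card = 4 := by
    rw [Finset.card_insert_of_notMem (by simp [d01, d02, d03]),
      Finset.card_insert_of_notMem (by simp [d12, d13]),
      Finset.card_insert_of_notMem (by simp [d23]), Finset.card_singleton]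
  have hcard4 : ({x₁, x₂, x₃, x₄} : Finset (AlgebraicClosure F)).card = 4 := by
    rw [Finset.card_insert_of_notMem (by simp [h12, h13, h14]),
      Finset.card_insert_of_notMem (by simp [h23, h24]),
      Finset.card_insert_of_notMem (by simp [h34]), Finset.card_singleton]
  have heqS : ({a₀, a₁, a₂, a₃} : Finset (AlgebraicClosure F)) = {x₁, x₂, x₃, x₄} :=
    Finset.eq_of_subset_of_card_le hsub (by rw [hcardS, hcard4])
  have hx₁ : x₁ ∈ ({a₀, a₁, a₂, a₃} : Finset (AlgebraicClosure F)) := by rw [heqS]; simp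
  simp only [Finset.mem_insert, Finset.mem_singleton] at hx₁
  rcases hx₁ with h | h | h | h
  · exact ⟨P, b₀, h ▸ ha₀, by rw [hR₀]; subst h; rfl⟩
  · exact ⟨Q, b₁, h ▸ ha₁, by rw [hR₁]; subst h; rfl⟩
  · exact ⟨P + Q, b₂, h ▸ ha₂, by rw [hR₂]; subst h; rfl⟩
  · exact ⟨P - Q, b₃, h ▸ ha₃, by rw [hR₃]; subst h; rfl⟩

end Roots

/-! ### Cardinalities of the ramification groups of the named fields -/

section Cardinalities

variable {K : Type u} [Field K] [NumberField K]

set_option synthInstance.maxHeartbeats 400000 in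
/-- **`#G₁(𝔓 ∩ L) = 2^{v₂(#G₀(𝔓 ∩ L))}` at a prime above `2`** for any finite normal subextension
`L/K` of `K̄` (`G₁` is a `2`-group of odd index in `G₀`; `card_ramificationSubgroup_one_eq_pow_factorization`).
So `#G₁ ∈ {8}` as soon as `8 ∣ e(𝔓 ∩ L ∣ v) ∣ 24`.
[cite: SerreLocalFields1979, Ch. IV §2 Cor. 1 and Cor. 3 of Prop. 7] -/
theorem card_ramificationSubgroup_one_eq_two_pow_of_mem_primesAbove
    {v : HeightOneSpectrum (𝓞 K)} (hv2 : (2 : 𝓞 K) ∈ v.asIdeal)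
    {𝔓 : Ideal (absIntegers (𝓞 K) K)} (h𝔓 : 𝔓 ∈ v.primesAbove)
    (L : IntermediateField K (AlgebraicClosure K)) [FiniteDimensional K L] [Normal K L] :
    Nat.card ((𝔓.comap (L.integralClosureToAbsIntegers (𝓞 K))).ramificationSubgroup (L ≃ₐ[K] L) 1) =
      2 ^ (Nat.card ((𝔓.comap (L.integralClosureToAbsIntegers (𝓞 K))).ramificationSubgroup
        (L ≃ₐ[K] L) 0)).factorization 2 := by
  haveI : 𝔓.IsPrime := h𝔓.1
  haveI : 𝔓.IsMaximal := HeightOneSpectrum.isMaximal_of_mem_primesAbove h𝔓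
  haveI : IsGalois K L := {}
  haveI hDD : IsDedekindDomain (integralClosure (𝓞 K) L) :=
    integralClosure.isDedekindDomain (𝓞 K) K L
  haveI hPLmax : (𝔓.comap (L.integralClosureToAbsIntegers (𝓞 K))).IsMaximal :=
    isMaximal_comap_integralClosureToAbsIntegers (𝓞 K) 𝔓 L
  have hunder : (𝔓.comap (L.integralClosureToAbsIntegers (𝓞 K))).under (𝓞 K) = v.asIdeal := by
    rw [under_comap_integralClosureToAbsIntegers, ← h𝔓.2.over]
  -- residue characteristic `2` of `v` and of `𝔓 ∩ L`
  have hp2 : ringChar (𝓞 K ⧸ v.asIdeal) = 2 := by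
    have hpprime : (ringChar (𝓞 K ⧸ v.asIdeal)).Prime := by
      haveI : Finite (𝓞 K ⧸ v.asIdeal) := Ideal.finiteQuotientOfFreeOfNeBot v.asIdeal v.ne_bot
      exact CharP.char_is_prime (𝓞 K ⧸ v.asIdeal) _
    have h0 : ((2 : ℕ) : 𝓞 K ⧸ v.asIdeal) = 0 := by
      rw [← map_natCast (Ideal.Quotient.mk v.asIdeal), Ideal.Quotient.eq_zero_iff_mem]
      exact_mod_cast hv2
    exact (Nat.prime_dvd_prime_iff_eq hpprime Nat.prime_two).mp ((ringChar.spec _ _).mp h0)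
  have h2abs : (2 : absIntegers (𝓞 K) K) ∈ 𝔓 := by
    have h : (2 : 𝓞 K) ∈ 𝔓.under (𝓞 K) := by rw [← h𝔓.2.over]; exact hv2
    rw [Ideal.under_def, Ideal.mem_comap, map_ofNat] at h
    exact h
  have hPL0 : 𝔓.comap (L.integralClosureToAbsIntegers (𝓞 K)) ≠ ⊥ := by
    intro h0
    have hinj : Function.Injective (algebraMap (𝓞 K) (integralClosure (𝓞 K) L)) :=
      (faithfulSMul_iff_algebraMap_injective _ _).mp
        (faithfulSMul_integralClosure (𝓞 K) (K := K) (L := L))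
    have h : (2 : 𝓞 K) ∈ (𝔓.comap (L.integralClosureToAbsIntegers (𝓞 K))).under (𝓞 K) := by
      rw [hunder]; exact hv2
    rw [Ideal.under_def, Ideal.mem_comap, h0, Ideal.mem_bot] at h
    exact two_ne_zero (hinj (h.trans (map_zero _).symm))
  -- finite residue field of `𝔓 ∩ L`
  haveI hfinq : Finite (integralClosure (𝓞 K) L ⧸ 𝔓.comap (L.integralClosureToAbsIntegers (𝓞 K))) := by
    have hmodfin : Module.Finite (𝓞 K) (integralClosure (𝓞 K) L) :=
      IsIntegralClosure.finite (𝓞 K) K L (integralClosure (𝓞 K) L)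
    haveI hlies : (𝔓.comap (L.integralClosureToAbsIntegers (𝓞 K))).LiesOver (𝔓.under (𝓞 K)) :=
      ⟨(under_comap_integralClosureToAbsIntegers (𝓞 K) 𝔓 L).symm⟩
    haveI : Finite ((𝓞 K) ⧸ 𝔓.under (𝓞 K)) := by
      rw [← h𝔓.2.over]; exact Ideal.finiteQuotientOfFreeOfNeBot v.asIdeal v.ne_bot
    haveI : Module.Finite ((𝓞 K) ⧸ 𝔓.under (𝓞 K))
        (integralClosure (𝓞 K) L ⧸ 𝔓.comap (L.integralClosureToAbsIntegers (𝓞 K))) :=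
      @module_finite_of_liesOver (𝓞 K) (integralClosure (𝓞 K) L) _ _ _
        (𝔓.comap (L.integralClosureToAbsIntegers (𝓞 K))) (𝔓.under (𝓞 K)) hlies hmodfin
    exact Module.finite_of_finite ((𝓞 K) ⧸ 𝔓.under (𝓞 K))
  haveI : Fact (Nat.Prime 2) := ⟨Nat.prime_two⟩
  have hG1 : IsPGroup 2 ((𝔓.comap (L.integralClosureToAbsIntegers (𝓞 K))).ramificationSubgroup
      (L ≃ₐ[K] L) 1) := by
    have := isPGroup_ramificationSubgroup_one_of_mem_primesAbove h𝔓 L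
    rwa [hp2] at this
  have hcop := @relIndex_ramificationSubgroup_one_coprime_ringChar (integralClosure (𝓞 K) L) _ hDD
    (L ≃ₐ[K] L) _ _ (𝔓.comap (L.integralClosureToAbsIntegers (𝓞 K))) hPLmax hfinq hPL0
  -- the residue characteristic of `𝔓 ∩ L` is `2`
  have key : ∀ c : ℕ, c ∣ 2 → c ≠ 1 → 2 ∣ c := by
    intro c hc hc1
    rcases (Nat.dvd_prime Nat.prime_two).mp hc with h | h
    · exact absurd h hc1
    · rw [h]
  refine card_ramificationSubgroup_one_eq_pow_factorization hG1 (hcop.coprime_dvd_right ?_)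
  refine key _ (ringChar.dvd ?_) CharP.ringChar_ne_one
  rw [Nat.cast_ofNat, ← map_ofNat (Ideal.Quotient.mk _) 2, Ideal.Quotient.eq_zero_iff_mem,
    Ideal.mem_comap, map_ofNat]
  exact h2abs

end Cardinalities

/-! ### The named fields `K(E[3]) ⊇ K(x(E[3]))` -/

section DivisionFields

variable {K : Type u} [Field K] [NumberField K] (W : WeierstrassCurve K)

/-- **`σ|_{K(x(E[3]))} = 1 ↔ σ|_{K(E[3])} ∈ {1, ι}`** for `ι ∈ Gal(K(E[3])/K)` acting as `-1` on
`E[3]` (`absRestrictNormalHom_eq_one_iff_of_forall_x` with the kernel characterisations of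
`DivisionField`): hypothesis `hkerE` of the Swan-conductor theorems for the named fields.
[cite: SilvermanAEC2009, III.2.3 and VIII.§1] -/
theorem absRestrictNormalHom_xDivisionField_eq_one_iff_divisionField [W.IsElliptic]
    {ι : W.divisionField 3 ≃ₐ[K] W.divisionField 3}
    (hι : ∀ σ : absoluteGaloisGroup K, absRestrictNormalHom (W.divisionField 3) σ = ι →
      ∀ T : geomTorsion W (3 : ℕ), σ • T = -T)
    (σ : absoluteGaloisGroup K) :
    absRestrictNormalHom (W.xDivisionField 3) σ = 1 ↔
      absRestrictNormalHom (W.divisionField 3) σ = 1 ∨ absRestrictNormalHom (W.divisionField 3) σ = ι := by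
  haveI : Fact (Nat.Prime 3) := ⟨Nat.prime_three⟩
  exact W.absRestrictNormalHom_eq_one_iff_of_forall_x 3 (by norm_num) (W.divisionField 3)
    (fun σ h => (W.absRestrictNormalHom_divisionField_eq_one_iff 3 σ).mp h)
    (fun σ h => (W.absRestrictNormalHom_divisionField_eq_one_iff 3 σ).mpr h)
    hι (W.xDivisionField 3) (W.absRestrictNormalHom_xDivisionField_eq_one_iff 3) σ

/-- **If `K(E[3])` is wildly ramified at `𝔓 ∣ 2`, some `ι ∈ G₁(𝔓 ∩ K(E[3]))` with `ι² = 1 ≠ ι` acts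
as `-1` on `E[3]`** (`exists_smul_eq_neg_of_ramificationSubgroup_one_ne_bot` for the named field;
wildness follows e.g. from an even ramification index,
`ramificationSubgroup_one_ne_bot_of_ringChar_dvd_card`).
[cite: SilvermanATAEC1994, proof of Thm. IV.11.1 (PDF p. 370)] [cite: SerreLocalFields1979, Ch. IV §2 Cor. 3 of Prop. 7] -/
theorem exists_central_involution_divisionField_three [W.IsElliptic]
    {v : HeightOneSpectrum (𝓞 K)} (hv2 : (2 : 𝓞 K) ∈ v.asIdeal) (h3 : ((3 : ℕ) : 𝓞 K) ∉ v.asIdeal)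
    {𝔓 : Ideal (absIntegers (𝓞 K) K)} (h𝔓 : 𝔓 ∈ v.primesAbove)
    (hne : (𝔓.comap ((W.divisionField 3).integralClosureToAbsIntegers (𝓞 K))).ramificationSubgroup
      (W.divisionField 3 ≃ₐ[K] W.divisionField 3) 1 ≠ ⊥) :
    ∃ ι ∈ (𝔓.comap ((W.divisionField 3).integralClosureToAbsIntegers (𝓞 K))).ramificationSubgroup
        (W.divisionField 3 ≃ₐ[K] W.divisionField 3) 1,
      ι ≠ 1 ∧ ι * ι = 1 ∧
      ∀ σ : absoluteGaloisGroup K, absRestrictNormalHom (W.divisionField 3) σ = ι →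
        ∀ T : geomTorsion W (3 : ℕ), σ • T = -T := by
  haveI : Fact (Nat.Prime 3) := ⟨Nat.prime_three⟩
  exact W.exists_smul_eq_neg_of_ramificationSubgroup_one_ne_bot 3 hv2 h3 h𝔓 (W.divisionField 3)
    (fun σ h => (W.absRestrictNormalHom_divisionField_eq_one_iff 3 σ).mp h)
    (fun σ h => (W.absRestrictNormalHom_divisionField_eq_one_iff 3 σ).mpr h) hne

/-- **`Sw_𝔓(E[3]) = 2 φ_{K(x(E[3]))/K}(b)`** at a prime `𝔓 ∣ v ∋ 2` (`v ∤ 3`) of a number field,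
for `ι ∈ Gal(K(E[3])/K)` acting as `-1` on `E[3]` with `i(ι) = b + 1` at `𝔓 ∩ K(E[3])`: the
wild conductor above `2` of any elliptic curve is twice the value at `b` of the Herbrand function
of its `x`-coordinate field (`swanConductorAt_torsion_eq_two_mul_herbrandPhi_quotient` for the
named fields of `DivisionField`).
[cite: SilvermanATAEC1994, §IV.10 Definition of δ (PDF p. 358), Thm. IV.11.1 p = 2 (p. 366)]
[cite: SerreLocalFields1979, Ch. IV §3 Prop. 15] -/
theorem swanConductorAt_torsion_three_eq_two_mul_herbrandPhi_xDivisionField [W.IsElliptic]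
    {v : HeightOneSpectrum (𝓞 K)} (hv2 : (2 : 𝓞 K) ∈ v.asIdeal) (h3 : ((3 : ℕ) : 𝓞 K) ∉ v.asIdeal)
    {𝔓 : Ideal (absIntegers (𝓞 K) K)} (h𝔓 : 𝔓 ∈ v.primesAbove)
    {ι : W.divisionField 3 ≃ₐ[K] W.divisionField 3}
    (hι : ∀ σ : absoluteGaloisGroup K, absRestrictNormalHom (W.divisionField 3) σ = ι →
      ∀ T : geomTorsion W (3 : ℕ), σ • T = -T)
    {b : ℕ} (hb : lowerIndex (𝔓.comap ((W.divisionField 3).integralClosureToAbsIntegers (𝓞 K)))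
      (W.divisionField 3 ≃ₐ[K] W.divisionField 3) ι = b + 1) :
    (W.torsionGaloisRep 3).swanConductorAt (𝓞 K) 𝔓 =
      2 * herbrandPhi (𝔓.comap ((W.xDivisionField 3).integralClosureToAbsIntegers (𝓞 K)))
        (W.xDivisionField 3 ≃ₐ[K] W.xDivisionField 3) b := by
  haveI : Fact (Nat.Prime 3) := ⟨Nat.prime_three⟩
  exact W.swanConductorAt_torsion_eq_two_mul_herbrandPhi_quotient 3 hv2 h3 h𝔓 (W.divisionField 3)
    (fun σ h => (W.absRestrictNormalHom_divisionField_eq_one_iff 3 σ).mp h)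
    (fun σ h => (W.absRestrictNormalHom_divisionField_eq_one_iff 3 σ).mpr h) hι hb
    (W.xDivisionField 3) (W.xDivisionField_le_divisionField 3)
    (W.absRestrictNormalHom_xDivisionField_eq_one_iff_divisionField hι)

/-- **`#Q₀ · Sw_𝔓(E[3]) = 2 (b + Σ_{j=2}^{4} (m_j - n))` from the roots of `Ψ₃`** — the wild
conductor above `2` for quaternion wild inertia (`#Q₁(𝔓 ∩ K(x(E[3]))) = 4`), with `ι ∈ G₁`
acting as `-1`, `i(ι) = b + 1`, the four distinct roots `x₁, …, x₄ ∈ K̄` of `Ψ₃`, and test elements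
`Z, Z₂, Z₃, Z₄ ∈ S_{K(x(E[3]))}` transported along `x₁ ↦ x_j`, `v(Z) = n` odd, `v(Z_j - Z) = m_j`,
`m_j - n ≤ b` (`card_mul_swanConductorAt_torsion_eq_of_roots` for the named fields, the
hypotheses on the `x`-coordinates being supplied by `x_mem_of_roots_divisionPolynomial_three_eq` and
`exists_geomTorsion_three_of_roots_divisionPolynomial_three_eq`).
[cite: SilvermanATAEC1994, §IV.10 Definition of δ (PDF p. 358), Thm. IV.11.1 p = 2 (p. 366)]
[cite: SerreLocalFields1979, Ch. IV §§1–3] -/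
theorem card_mul_swanConductorAt_torsion_three_eq_of_roots_divisionPolynomial_three [W.IsElliptic]
    {v : HeightOneSpectrum (𝓞 K)} (hv2 : (2 : 𝓞 K) ∈ v.asIdeal) (h3 : ((3 : ℕ) : 𝓞 K) ∉ v.asIdeal)
    {𝔓 : Ideal (absIntegers (𝓞 K) K)} (h𝔓 : 𝔓 ∈ v.primesAbove)
    {ι : W.divisionField 3 ≃ₐ[K] W.divisionField 3}
    (hι : ∀ σ : absoluteGaloisGroup K, absRestrictNormalHom (W.divisionField 3) σ = ι →
      ∀ T : geomTorsion W (3 : ℕ), σ • T = -T)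
    (h1 : ι ∈ (𝔓.comap ((W.divisionField 3).integralClosureToAbsIntegers (𝓞 K))).ramificationSubgroup
      (W.divisionField 3 ≃ₐ[K] W.divisionField 3) 1)
    {b : ℕ} (hb : lowerIndex (𝔓.comap ((W.divisionField 3).integralClosureToAbsIntegers (𝓞 K)))
      (W.divisionField 3 ≃ₐ[K] W.divisionField 3) ι = b + 1)
    (hcard : Nat.card ((𝔓.comap ((W.xDivisionField 3).integralClosureToAbsIntegers (𝓞 K))).ramificationSubgroup
      (W.xDivisionField 3 ≃ₐ[K] W.xDivisionField 3) 1) = 4)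
    {x₁ x₂ x₃ x₄ : AlgebraicClosure K} (h12 : x₁ ≠ x₂) (h13 : x₁ ≠ x₃) (h14 : x₁ ≠ x₄)
    (h23 : x₂ ≠ x₃) (h24 : x₂ ≠ x₄) (h34 : x₃ ≠ x₄)
    (hΨ : (W.baseChange (AlgebraicClosure K)).Ψ₃.roots = {x₁, x₂, x₃, x₄})
    {Z Z₂ Z₃ Z₄ : integralClosure (𝓞 K) (W.xDivisionField 3)}
    (hZ₂ : ∀ σ : absoluteGaloisGroup K, σ • x₁ = x₂ →
      σ • ((Z : W.xDivisionField 3) : AlgebraicClosure K) = ((Z₂ : W.xDivisionField 3) : AlgebraicClosure K))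
    (hZ₃ : ∀ σ : absoluteGaloisGroup K, σ • x₁ = x₃ →
      σ • ((Z : W.xDivisionField 3) : AlgebraicClosure K) = ((Z₃ : W.xDivisionField 3) : AlgebraicClosure K))
    (hZ₄ : ∀ σ : absoluteGaloisGroup K, σ • x₁ = x₄ →
      σ • ((Z : W.xDivisionField 3) : AlgebraicClosure K) = ((Z₄ : W.xDivisionField 3) : AlgebraicClosure K))
    {n m₂ m₃ m₄ : ℕ}
    (hn : ord (𝔓.comap ((W.xDivisionField 3).integralClosureToAbsIntegers (𝓞 K))) Z = n)
    (hnu : (n : integralClosure (𝓞 K) (W.xDivisionField 3)) ∉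
      𝔓.comap ((W.xDivisionField 3).integralClosureToAbsIntegers (𝓞 K)))
    (hm₂ : ord (𝔓.comap ((W.xDivisionField 3).integralClosureToAbsIntegers (𝓞 K))) (Z₂ - Z) = m₂)
    (hm₃ : ord (𝔓.comap ((W.xDivisionField 3).integralClosureToAbsIntegers (𝓞 K))) (Z₃ - Z) = m₃)
    (hm₄ : ord (𝔓.comap ((W.xDivisionField 3).integralClosureToAbsIntegers (𝓞 K))) (Z₄ - Z) = m₄)
    (hm₂b : m₂ - n ≤ b) (hm₃b : m₃ - n ≤ b) (hm₄b : m₄ - n ≤ b) :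
    (Nat.card ((𝔓.comap ((W.xDivisionField 3).integralClosureToAbsIntegers (𝓞 K))).ramificationSubgroup
        (W.xDivisionField 3 ≃ₐ[K] W.xDivisionField 3) 0) : ℝ) *
        (W.torsionGaloisRep 3).swanConductorAt (𝓞 K) 𝔓 =
      2 * (b + (((m₂ - n) + (m₃ - n) + (m₄ - n) : ℕ) : ℝ)) := by
  haveI : Fact (Nat.Prime 3) := ⟨Nat.prime_three⟩
  obtain ⟨T₁, y₁, hns₁, hT₁⟩ :=
    W.exists_geomTorsion_three_of_roots_divisionPolynomial_three_eq hΨ h12 h13 h14 h23 h24 h34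
  exact W.card_mul_swanConductorAt_torsion_eq_of_roots hv2 h3 h𝔓 (W.divisionField 3)
    (fun σ h => (W.absRestrictNormalHom_divisionField_eq_one_iff 3 σ).mp h)
    (fun σ h => (W.absRestrictNormalHom_divisionField_eq_one_iff 3 σ).mpr h) hι h1 hb
    (W.xDivisionField 3) (W.xDivisionField_le_divisionField 3)
    (W.absRestrictNormalHom_xDivisionField_eq_one_iff_divisionField hι) hcard h23 h24 h34
    (W.x_mem_of_roots_divisionPolynomial_three_eq hΨ) hT₁ (W.mem_xDivisionField_of_eq_some 3 hT₁) hZ₂ hZ₃ hZ₄ hn hnu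
    hm₂ hm₃ hm₄ hm₂b hm₃b hm₄b

/-- **`#G₀(𝔓 ∩ K(E[3])) = 2 · #Q₀(𝔓 ∩ K(x(E[3])))`** for `ι` acting as `-1` in the inertia
group (`card_ramificationSubgroup_zero_eq_two_mul_layer` for the named fields).
[cite: SerreLocalFields1979, Ch. I §7 Prop. 22 and Ch. IV §1 Prop. 2] -/
theorem card_ramificationSubgroup_zero_divisionField_three_eq_two_mul [W.IsElliptic]
    {v : HeightOneSpectrum (𝓞 K)} {𝔓 : Ideal (absIntegers (𝓞 K) K)} (h𝔓 : 𝔓 ∈ v.primesAbove)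
    {ι : W.divisionField 3 ≃ₐ[K] W.divisionField 3}
    (hι : ∀ σ : absoluteGaloisGroup K, absRestrictNormalHom (W.divisionField 3) σ = ι →
      ∀ T : geomTorsion W (3 : ℕ), σ • T = -T)
    (h0 : ι ∈ (𝔓.comap ((W.divisionField 3).integralClosureToAbsIntegers (𝓞 K))).ramificationSubgroup
      (W.divisionField 3 ≃ₐ[K] W.divisionField 3) 0) :
    Nat.card ((𝔓.comap ((W.divisionField 3).integralClosureToAbsIntegers (𝓞 K))).ramificationSubgroup
        (W.divisionField 3 ≃ₐ[K] W.divisionField 3) 0) =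
      2 * Nat.card ((𝔓.comap ((W.xDivisionField 3).integralClosureToAbsIntegers (𝓞 K))).ramificationSubgroup
        (W.xDivisionField 3 ≃ₐ[K] W.xDivisionField 3) 0) := by
  haveI : Fact (Nat.Prime 3) := ⟨Nat.prime_three⟩
  have hι1 : ι ≠ 1 := W.ne_one_of_smul_eq_neg 3 (by norm_num) (W.divisionField 3)
    (fun σ h => (W.absRestrictNormalHom_divisionField_eq_one_iff 3 σ).mp h) hι
  exact card_ramificationSubgroup_zero_eq_two_mul_layer (W.divisionField 3) (W.xDivisionField 3) h𝔓
    (W.xDivisionField_le_divisionField 3) hι1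
    (W.absRestrictNormalHom_xDivisionField_eq_one_iff_divisionField hι) h0

/-- **`#G₁(𝔓 ∩ K(E[3])) = 2 · #Q₁(𝔓 ∩ K(x(E[3])))`** for `ι` acting as `-1` in the wild inertia
group (`card_ramificationSubgroup_one_eq_two_mul_layer` for the named fields); with
`card_ramificationSubgroup_one_eq_two_pow_of_mem_primesAbove` this gives the hypothesis
`#Q₁ = 4` of `card_mul_swanConductorAt_torsion_three_eq_of_roots_divisionPolynomial_three` from
`8 ∣ e(𝔓 ∩ K(E[3]) ∣ v) ∣ 24`.
[cite: SerreLocalFields1979, Ch. IV §3 Lemma 5 and §1 Prop. 2] -/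
theorem card_ramificationSubgroup_one_divisionField_three_eq_two_mul [W.IsElliptic]
    {v : HeightOneSpectrum (𝓞 K)} {𝔓 : Ideal (absIntegers (𝓞 K) K)} (h𝔓 : 𝔓 ∈ v.primesAbove)
    {ι : W.divisionField 3 ≃ₐ[K] W.divisionField 3}
    (hι : ∀ σ : absoluteGaloisGroup K, absRestrictNormalHom (W.divisionField 3) σ = ι →
      ∀ T : geomTorsion W (3 : ℕ), σ • T = -T)
    (h1 : ι ∈ (𝔓.comap ((W.divisionField 3).integralClosureToAbsIntegers (𝓞 K))).ramificationSubgroup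
      (W.divisionField 3 ≃ₐ[K] W.divisionField 3) 1) :
    Nat.card ((𝔓.comap ((W.divisionField 3).integralClosureToAbsIntegers (𝓞 K))).ramificationSubgroup
        (W.divisionField 3 ≃ₐ[K] W.divisionField 3) 1) =
      2 * Nat.card ((𝔓.comap ((W.xDivisionField 3).integralClosureToAbsIntegers (𝓞 K))).ramificationSubgroup
        (W.xDivisionField 3 ≃ₐ[K] W.xDivisionField 3) 1) := by
  haveI : Fact (Nat.Prime 3) := ⟨Nat.prime_three⟩
  have hι1 : ι ≠ 1 := W.ne_one_of_smul_eq_neg 3 (by norm_num) (W.divisionField 3)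
    (fun σ h => (W.absRestrictNormalHom_divisionField_eq_one_iff 3 σ).mp h) hι
  exact card_ramificationSubgroup_one_eq_two_mul_layer (W.divisionField 3) (W.xDivisionField 3) h𝔓
    (W.xDivisionField_le_divisionField 3) hι1
    (W.absRestrictNormalHom_xDivisionField_eq_one_iff_divisionField hι) h1

end DivisionFields

end WeierstrassCurve

end
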